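import Summits.QuantumFields.BalabanUV.Beta.SymSecondOrderTablesAn1

/-!
# `BalabanUV.Beta.SymTablesAn1S2Weighted` — binder row D1, chart (III″) supply (leaf-04): THE (0.4) TABLE RECORD OF ROW D1 AT A WEIGHTED
# MIXED SLOT `symTablesAn1S2w d Lc cΛ w` — an1 S2b's closed record `symTablesAn1S2 d Lc cΛ` with its mixed field–multiplier socket filled by
# `w • symMixFFAt ρ_c Lc` instead of `symMixFFAt ρ_c Lc`, its two letters (Lmix-w)(Tmix-w), and `symTablesAn1S2w d Lc cΛ 1 = symTablesAn1S2 d Lc cΛ`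

HONEST FRAMING (cell contract, verbatim): «discharging `BetaPertH` makes Bałaban's UV stability UNCONDITIONAL — a real constructive-QFT
result; it is NOT the continuum limit and NOT the Clay problem.»  THIS MODULE DISCHARGES NOTHING of `BetaPertH` ∕ row D1.  It is [folklore]
bookkeeping BY NAME over an1's `SymSecondOrderTablesAn1` (§3, the closed record) and Mathlib's `•`: 0 sorry, 0 `def … : Prop`, nothing cited as a
fact, no value of any table asserted, NO pin asserted (both `cΛ` and `w` are parameters).  NOT D1, NOT BetaPertH, NOT continuum, NOT Clay.

WHY (row D1 ∕ (C1) OWNER an2 g56, `(III″) SPEC v0.4` §2″∕§4 + RULING R-D1-g56-3 (A-1∕A-2) + the RCPT-3 plan (R4-7)): the (III″) literal is the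
(III′) literal `JsB12CombShSym hLc N tabs cΛ cB` with the Λ group «weighted like the border group» — first-order pin `cΛ′ = Lc⁸∕2` on the `SLam`
slot and MIXED-SLOT WEIGHT `Lc¹²∕4` («today weight 1»), `M1Of`'s weight pending.  In the tree the mixed table enters the record ONLY through the
field `SymTables.mixFF` (consumed as `WrecOf … cE₂ cB T tabs.vh₂S tabs.mixFF` and `BalabanStepW2.M2Of mixFF j = wM2 j • mixFF`) — it carries NO
scalar pin of its own (unlike `cB` for `vh₂S`), so a mixed-slot weight is realised AT THE RECORD: this file is that record, for EVERY weight `w`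
and EVERY multiplier-table pin `cΛ` (the record's `M := M1Of d Lc (symHessFFAt ρ_c Lc) cΛ` keeps its own `cΛ`, a parameter SEPARATE from whatever
first-order pin the root passes to `JsB12CombShSym`).  At `d = 3` the record's `mixFF` is an2 INTENT-3's `CombMixedT2SiteLetterScaled.wmix Lc w`
BY TERM (`w • symMixFFAt (ctr 4 Lc) Lc`).

WHAT:
* §1 the two letters of the weighted mixed table, box root and centred root: **(Lmix-w)** `smul_symMixFFAt_hmix(_ctr)`
  (`∃ C δ, 0 < δ ∧ LocStencilFM L (w • symMixFFAt ρ L) C δ` — an1's (Lmix) with constant `|w|·C`, same rate, by `StepJetData.biLoc_smul`) and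
  **(Tmix-w)** `smul_symMixFFAt_hmixt` (translation covariance is linear; `shiftK` commutes with `•` by `rfl`);
* §2 **THE WEIGHTED RECORD** `symTablesAn1S2w d Lc cΛ w := symTablesAn1 d Lc cΛ (symVh₂SAn1 d Lc) (w • symMixFFAt ρ_c Lc) hB (Lmix-w) hBt (Tmix-w)`
  (only `[NeZero Lc]`), its `rfl` field lemmas, the field-wise comparison with an1's record (`V, H, M, vh₂S` IDENTICAL; `mixFF = w • _`), the
  block-vanishing lemmas of the weighted mixed table, **`symTablesAn1S2w_one : symTablesAn1S2w d Lc cΛ 1 = symTablesAn1S2 d Lc cΛ`** (by the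
  constructor congruence `symTablesAn1_congr_mixFF` — proof-irrelevance on the two letters) and `symTablesAn1S2w_zero_mixFF`;
* §3 two sockets for the root's author, BY TERM: `M2Of_symTablesAn1S2w_mixFF` (`M2Of d Lc (record w).mixFF j = w • M2Of d Lc (record 1).mixFF j`
  = `(wM2 j * w) • symMixFFAt ρ_c Lc` pointwise — the SPEC's «mixFF ↦ κ•mixFF» in the data slot) and the d = 3 WEIGHT LOCK at weight `w`,
  `weightLock_of_lock : cΛ·Lc⁴ = 2·w → ∀ j, cΛ·wM1_j·γ_j = −(w·wM2_j)` for the displayed `γ_j = −(Lc⁸∕2)·wVH_j∕(stepScale_j·Lc⁴)` (the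
  `w`-twin of `CombRemainderTadpoleSlot.lock_of_hΛ`; at `w = 1` it is that lemma's statement; the homogeneous lock of INTENT-3).
NOT HERE (the OWNER's, after `R-AN2-56-ATK`): the (III″) root; the κ-scaled (T2-M₂) ∕ remainder ∕ parity chain; any pin value (`w = Lc¹²∕4`,
`cΛ′ = Lc⁸∕2`); any edit of ROOT M‴ p325680 or of an1's files; any value of any table; any word of the (III″) word list.
HONEST DEPENDENCY (verbatim): «continuum YM on T⁴ ⇐ BetaPertH ∧ nine spine estimates (0/9 proved); BetaPertH ⇐ (D1) ∧ (D4) ∧ CAP+tail;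
G-an2-4 gates asym, D1 and NE2/3/4.»  ABSOLUTE RULE (cell, verbatim): «No internally-minted statement may enter as a cited fact. Every
hypothesis is either kernel-proved in this package or a verbatim quotation of a PUBLISHED theorem with page reference.»
Provenance: β sub-cell, D1 formalisation swarm leaf prover 04 (`b2b-balaban-beta-d1-formalise-leaf-04` gen 33), 2026-08-25 (v1; OFFER O-g33-1
«S2-RECORD-W», zero weight until the row OWNER's word); over an1's `SymSecondOrderTablesAn1` ∕ `SymAveragingMixedJetTables` ∕
`SymTablesAn1FirstOrder` BY NAME; no existing file touched.
-/

open Finset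
open scoped BigOperators
open Literature.MathematicalPhysics.QuantumFieldTheory
open Literature.MathematicalPhysics.QuantumFieldTheory.Balaban1983to89
open Literature.MathematicalPhysics.QuantumFieldTheory.Balaban1983to89.Beta
open ExpKernelCalculus (MKer BiLoc shiftK)
open AffineAveraging (box toSite)
open AveragingContoursRooted (ctr ctrOff ctrOff_mem_box)
open OneStepResolventKernel (Fib LocStencil)
open StepJetData (biLoc_smul)
open BalabanCompositeJets (LocStencil₂)
open SecondOrderResponse (LocStencilFM)
open BalabanStepJetsSucc (wVH)
open BalabanStepW2 (wM1 wM2 M2Of)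
open Summit.QuantumFields.BalabanUV.Beta.AxialDressingRooted (one_le_of_neZero)
open Summit.QuantumFields.BalabanUV.Beta.BorderedHessian (stepScale)
open Summit.QuantumFields.BalabanUV.Beta.SpineRooted (M1Of)
open Summit.QuantumFields.BalabanUV.Beta.SymmetrisedStepJets (SymTables)
open Summit.QuantumFields.BalabanUV.Beta.SymAveragingHessianCounts (symVhSAt symHessFFAt)
open Summit.QuantumFields.BalabanUV.Beta.SymTablesAn1FirstOrder (symTablesAn1)
open Summit.QuantumFields.BalabanUV.Beta.SymAveragingMixedJetTables (symMixFFAt symMixFFAt_translate symMixFFAt_inr symMixFFAt_inl_inr)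
open Summit.QuantumFields.BalabanUV.Beta.SymSecondOrderTablesAn1 (symVh₂SAn1 symTablesAn1S2 locStencil₂_symVh₂SAn1 symVh₂SAn1_hBt
  symMixFFAt_hmix symMixFFAt_hmixt symTablesAn1S2_def symTablesAn1S2_mixFF)

namespace Summit.QuantumFields.BalabanUV.Beta.SymTablesAn1S2Weighted

noncomputable section

variable {d : ℕ}

/-! ## §1 The two letters of the weighted mixed table -/

section Letters

variable {L : ℕ} {r : Fin (d + 1) → ℕ}

/-- [folklore] **(Lmix-w), box root**: the weighted mixed table `w • symMixFFAt ρ L` is a localised field–multiplier family at the rate of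
an1's (Lmix), with constant `|w|·C` (`StepJetData.biLoc_smul`). -/
theorem smul_symMixFFAt_hmix (hL : 1 ≤ L) (hr : r ∈ box (d + 1) L) (w : ℝ) :
    ∃ C δ : ℝ, 0 < δ ∧ LocStencilFM L (w • symMixFFAt (toSite r) L) C δ := by
  obtain ⟨C, δ, hδ, h⟩ := symMixFFAt_hmix hL hr
  refine ⟨|w| * C, δ, hδ, fun κ u μ y => ?_⟩
  have h1 := biLoc_smul (h κ u μ y) w
  rw [← mul_assoc] at h1
  exact h1

/-- [folklore] **(Lmix-w) at the centred root** `ρ_c = ctr (d+1) L` (only `1 ≤ L`). -/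
theorem smul_symMixFFAt_hmix_ctr (hL : 1 ≤ L) (w : ℝ) : ∃ C δ : ℝ, 0 < δ ∧ LocStencilFM L (w • symMixFFAt (ctr (d + 1) L) L) C δ :=
  smul_symMixFFAt_hmix hL (ctrOff_mem_box hL) w

/-- [folklore] `shiftK` commutes with a scalar weight (definitional). -/
theorem shiftK_smul {D : ℕ} {F : Type*} (v : Fin D → ℤ) (w : ℝ) (K : MKer D F) : shiftK v (w • K) = w • shiftK v K := rfl

/-- [folklore] **(Tmix-w) in the record's shape** (all roots): translation covariance of the weighted mixed table (linear in the table: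
an1's `symMixFFAt_translate` under `w • _`). -/
theorem smul_symMixFFAt_hmixt (ρ : Fin (d + 1) → ℤ) (L : ℕ) (w : ℝ) :
    ∀ (κ : Fin (d + 1)) (u : Fin (d + 1) → ℤ) (μ : Fin (d + 1)) (y t : Fin (d + 1) → ℤ),
      (w • symMixFFAt ρ L) κ (u + (L : ℤ) • t) μ (y + t) = shiftK (-((L : ℤ) • t)) ((w • symMixFFAt ρ L) κ u μ y) := by
  intro κ u μ y t
  simp only [Pi.smul_apply, symMixFFAt_translate ρ L κ u μ y t]
  rfl

/-- [folklore] The weighted mixed table lives on the field–field block: it vanishes on `(inr, ·)`. -/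
@[simp] theorem smul_symMixFFAt_inr (ρ : Fin (d + 1) → ℤ) (L : ℕ) (w : ℝ) (κ : Fin (d + 1)) (u : Fin (d + 1) → ℤ) (μ : Fin (d + 1))
    (y x x' : Fin (d + 1) → ℤ) (μ' : Fin (d + 1)) (b : Fib d) : (w • symMixFFAt ρ L) κ u μ y x x' (Sum.inr μ') b = 0 := by
  simp only [Pi.smul_apply, symMixFFAt_inr, smul_eq_mul, mul_zero]

/-- [folklore] … and on `(inl, inr)`. -/
@[simp] theorem smul_symMixFFAt_inl_inr (ρ : Fin (d + 1) → ℤ) (L : ℕ) (w : ℝ) (κ : Fin (d + 1)) (u : Fin (d + 1) → ℤ) (μ : Fin (d + 1))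
    (y x x' : Fin (d + 1) → ℤ) (α μ' : Fin (d + 1)) : (w • symMixFFAt ρ L) κ u μ y x x' (Sum.inl α) (Sum.inr μ') = 0 := by
  simp only [Pi.smul_apply, symMixFFAt_inl_inr, smul_eq_mul, mul_zero]

end Letters

/-! ## §2 The weighted record -/

section Record

variable (d) (Lc : ℕ) [NeZero Lc]

/-- [our object] **THE (0.4) TABLE RECORD OF ROW D1 AT A WEIGHTED MIXED SLOT** (centred root `ρ_c = ctr (d+1) Lc`): an1's `symTablesAn1 d Lc cΛ`
with its two second-order sockets filled by `vh₂S := symVh₂SAn1 d Lc` (as in an1's closed record) and `mixFF := w • symMixFFAt ρ_c Lc` (the mixed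
table at weight `w`), letters (LB) `locStencil₂_symVh₂SAn1`, (Lmix-w) `smul_symMixFFAt_hmix_ctr`, (TB) `symVh₂SAn1_hBt`, (Tmix-w)
`smul_symMixFFAt_hmixt`.  No hypothesis beyond `[NeZero Lc]`; `cΛ` (the multiplier tables' pin) and `w` (the mixed-slot weight) are PARAMETERS —
no pin is asserted.  A CANDIDATE record for the (III″) literal; asserts nothing. -/
def symTablesAn1S2w (cΛ w : ℝ) : SymTables d Lc :=
  symTablesAn1 d Lc cΛ (symVh₂SAn1 d Lc) (w • symMixFFAt (ctr (d + 1) Lc) Lc) (locStencil₂_symVh₂SAn1 (one_le_of_neZero Lc))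
    (smul_symMixFFAt_hmix_ctr (one_le_of_neZero Lc) w) (symVh₂SAn1_hBt (one_le_of_neZero Lc)) (smul_symMixFFAt_hmixt (ctr (d + 1) Lc) Lc w)

variable {d Lc} (cΛ w : ℝ)

/-- [folklore] **UNFOLDING**: the weighted record IS the owner's displayed record at an1's border table and the weighted mixed table (`rfl`) —
every theorem stated for `symTablesAn1 d Lc cΛ vh₂S mixFF hB hmix hBt hmixt` specialises to `symTablesAn1S2w d Lc cΛ w` through this equation. -/
theorem symTablesAn1S2w_def : symTablesAn1S2w d Lc cΛ w =
    symTablesAn1 d Lc cΛ (symVh₂SAn1 d Lc) (w • symMixFFAt (ctr (d + 1) Lc) Lc) (locStencil₂_symVh₂SAn1 (one_le_of_neZero Lc))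
      (smul_symMixFFAt_hmix_ctr (one_le_of_neZero Lc) w) (symVh₂SAn1_hBt (one_le_of_neZero Lc)) (smul_symMixFFAt_hmixt (ctr (d + 1) Lc) Lc w) :=
  rfl

/-- [folklore] The weighted record's border table is an1's `symVhSAt ρ_c d Lc` (`rfl`). -/
@[simp] theorem symTablesAn1S2w_V : (symTablesAn1S2w d Lc cΛ w).V = symVhSAt (ctr (d + 1) Lc) d Lc := rfl

/-- [folklore] The weighted record's constraint Hessian is an1's `symHessFFAt ρ_c Lc` (`rfl`). -/
@[simp] theorem symTablesAn1S2w_H : (symTablesAn1S2w d Lc cΛ w).H = symHessFFAt (ctr (d + 1) Lc) Lc := rfl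

/-- [folklore] The weighted record's multiplier tables are `M1Of d Lc (symHessFFAt ρ_c Lc) cΛ` — the record's OWN pin `cΛ`, untouched by `w` (`rfl`). -/
@[simp] theorem symTablesAn1S2w_M : (symTablesAn1S2w d Lc cΛ w).M = M1Of d Lc (symHessFFAt (ctr (d + 1) Lc) Lc) cΛ := rfl

/-- [folklore] The weighted record's second-order border table is the row table `symVh₂SAn1 d Lc` (`rfl`). -/
@[simp] theorem symTablesAn1S2w_vh₂S : (symTablesAn1S2w d Lc cΛ w).vh₂S = symVh₂SAn1 d Lc := rfl

/-- [folklore] The weighted record's mixed table is `w • symMixFFAt ρ_c Lc` (`rfl`). -/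
@[simp] theorem symTablesAn1S2w_mixFF : (symTablesAn1S2w d Lc cΛ w).mixFF = w • symMixFFAt (ctr (d + 1) Lc) Lc := rfl

/-- [folklore] … pointwise: `(record w).mixFF κ u μ y = w • symMixFFAt ρ_c Lc κ u μ y` (`rfl`). -/
theorem symTablesAn1S2w_mixFF_apply (κ : Fin (d + 1)) (u : Fin (d + 1) → ℤ) (μ : Fin (d + 1)) (y : Fin (d + 1) → ℤ) :
    (symTablesAn1S2w d Lc cΛ w).mixFF κ u μ y = w • symMixFFAt (ctr (d + 1) Lc) Lc κ u μ y := rfl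

/-- [folklore] **FIELD-WISE COMPARISON WITH an1's CLOSED RECORD, I**: the four unweighted tables agree (`rfl` ×4, bundled). -/
theorem symTablesAn1S2w_tables_eq :
    (symTablesAn1S2w d Lc cΛ w).V = (symTablesAn1S2 d Lc cΛ).V ∧ (symTablesAn1S2w d Lc cΛ w).H = (symTablesAn1S2 d Lc cΛ).H ∧
      (symTablesAn1S2w d Lc cΛ w).M = (symTablesAn1S2 d Lc cΛ).M ∧ (symTablesAn1S2w d Lc cΛ w).vh₂S = (symTablesAn1S2 d Lc cΛ).vh₂S :=
  ⟨rfl, rfl, rfl, rfl⟩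

/-- [folklore] **FIELD-WISE COMPARISON WITH an1's CLOSED RECORD, II**: the mixed table is an1's at weight `w` (`rfl`). -/
theorem symTablesAn1S2w_mixFF_eq_smul : (symTablesAn1S2w d Lc cΛ w).mixFF = w • (symTablesAn1S2 d Lc cΛ).mixFF := rfl

/-- [folklore] The weighted record's mixed table vanishes on `(inr, ·)`. -/
theorem symTablesAn1S2w_mixFF_inr (κ : Fin (d + 1)) (u : Fin (d + 1) → ℤ) (μ : Fin (d + 1)) (y x x' : Fin (d + 1) → ℤ) (μ' : Fin (d + 1))
    (b : Fib d) : (symTablesAn1S2w d Lc cΛ w).mixFF κ u μ y x x' (Sum.inr μ') b = 0 :=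
  smul_symMixFFAt_inr (ctr (d + 1) Lc) Lc w κ u μ y x x' μ' b

/-- [folklore] … and on `(inl, inr)`. -/
theorem symTablesAn1S2w_mixFF_inl_inr (κ : Fin (d + 1)) (u : Fin (d + 1) → ℤ) (μ : Fin (d + 1)) (y x x' : Fin (d + 1) → ℤ) (α μ' : Fin (d + 1)) :
    (symTablesAn1S2w d Lc cΛ w).mixFF κ u μ y x x' (Sum.inl α) (Sum.inr μ') = 0 :=
  smul_symMixFFAt_inl_inr (ctr (d + 1) Lc) Lc w κ u μ y x x' α μ'

/-- [folklore] **CONSTRUCTOR CONGRUENCE IN THE MIXED SOCKET**: two instances of the owner's record with equal mixed tables are equal, whatever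
the (Prop-valued) letters supplied for them (proof irrelevance after `subst`). -/
theorem symTablesAn1_congr_mixFF (cΛ : ℝ)
    (vh₂S : Fin (d + 1) → (Fin (d + 1) → ℤ) → Fin (d + 1) → (Fin (d + 1) → ℤ) → MKer (d + 1) (Fib d))
    {mixFF mixFF' : Fin (d + 1) → (Fin (d + 1) → ℤ) → Fin (d + 1) → (Fin (d + 1) → ℤ) → MKer (d + 1) (Fib d)} (h : mixFF = mixFF')
    (hB : ∃ C δ : ℝ, 0 < δ ∧ LocStencil₂ vh₂S C δ)
    (hmix : ∃ C δ : ℝ, 0 < δ ∧ LocStencilFM Lc mixFF C δ) (hmix' : ∃ C δ : ℝ, 0 < δ ∧ LocStencilFM Lc mixFF' C δ)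
    (hBt : ∀ (κ : Fin (d + 1)) (u : Fin (d + 1) → ℤ) (κ' : Fin (d + 1)) (u' t : Fin (d + 1) → ℤ),
      vh₂S κ (u + (Lc : ℤ) • t) κ' (u' + (Lc : ℤ) • t) = shiftK (-((Lc : ℤ) • t)) (vh₂S κ u κ' u'))
    (hmixt : ∀ (κ : Fin (d + 1)) (u : Fin (d + 1) → ℤ) (μ : Fin (d + 1)) (y t : Fin (d + 1) → ℤ),
      mixFF κ (u + (Lc : ℤ) • t) μ (y + t) = shiftK (-((Lc : ℤ) • t)) (mixFF κ u μ y))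
    (hmixt' : ∀ (κ : Fin (d + 1)) (u : Fin (d + 1) → ℤ) (μ : Fin (d + 1)) (y t : Fin (d + 1) → ℤ),
      mixFF' κ (u + (Lc : ℤ) • t) μ (y + t) = shiftK (-((Lc : ℤ) • t)) (mixFF' κ u μ y)) :
    symTablesAn1 d Lc cΛ vh₂S mixFF hB hmix hBt hmixt = symTablesAn1 d Lc cΛ vh₂S mixFF' hB hmix' hBt hmixt' := by
  subst h
  rfl

/-- [folklore] **WEIGHT ONE IS an1's CLOSED RECORD**: `symTablesAn1S2w d Lc cΛ 1 = symTablesAn1S2 d Lc cΛ` — so every theorem of the M″∕M‴ chain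
stated at `symTablesAn1S2 d Lc cΛ` is the `w = 1` instance of its weighted twin, and conversely. -/
theorem symTablesAn1S2w_one : symTablesAn1S2w d Lc cΛ 1 = symTablesAn1S2 d Lc cΛ := by
  rw [symTablesAn1S2w_def, symTablesAn1S2_def]
  exact symTablesAn1_congr_mixFF cΛ (symVh₂SAn1 d Lc) (one_smul ℝ _) _ _ _ _ _ _

/-- [folklore] **WEIGHT ZERO EMPTIES THE MIXED SOCKET**: `(symTablesAn1S2w d Lc cΛ 0).mixFF = 0`. -/
theorem symTablesAn1S2w_zero_mixFF : (symTablesAn1S2w d Lc cΛ 0).mixFF = 0 := by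
  rw [symTablesAn1S2w_mixFF, zero_smul]

/-- [folklore] **WEIGHTS COMPOSE IN THE MIXED SOCKET**: `(record (w·w′)).mixFF = w • (record w′).mixFF`. -/
theorem symTablesAn1S2w_mul_mixFF (w' : ℝ) : (symTablesAn1S2w d Lc cΛ (w * w')).mixFF = w • (symTablesAn1S2w d Lc cΛ w').mixFF := by
  rw [symTablesAn1S2w_mixFF, symTablesAn1S2w_mixFF, mul_smul]

end Record

/-! ## §3 Two sockets for the root's author, by term -/

section Sockets

variable {Lc : ℕ} [NeZero Lc] (cΛ w : ℝ)

/-- [folklore] **THE WEIGHTED MIXED DATA SLOT, BY TERM**: `M2Of d Lc (record w).mixFF j = w • M2Of d Lc (an1's record).mixFF j` — the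
SPEC's «`mixFF ↦ κ • mixFF`» read in `BalabanStepW2.M2Of` (`= wM2 j • mixFF`), i.e. the mixed slot at weight `wM2 j · w`. -/
theorem M2Of_symTablesAn1S2w_mixFF (j : ℕ) :
    M2Of d Lc (symTablesAn1S2w d Lc cΛ w).mixFF j = w • M2Of d Lc (symTablesAn1S2 d Lc cΛ).mixFF j := by
  funext κ u ρ y
  rw [symTablesAn1S2w_mixFF, symTablesAn1S2_mixFF]
  show wM2 d Lc j • (w • symMixFFAt (ctr (d + 1) Lc) Lc) κ u ρ y = (w • fun κ u ρ y => wM2 d Lc j • symMixFFAt (ctr (d + 1) Lc) Lc κ u ρ y) κ u ρ y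
  simp only [Pi.smul_apply, smul_smul, mul_comm]

/-- [folklore] … pointwise with the product weight displayed: `M2Of d Lc (record w).mixFF j κ u ρ y = (wM2 j * w) • symMixFFAt ρ_c Lc κ u ρ y`. -/
theorem M2Of_symTablesAn1S2w_mixFF_apply (j : ℕ) (κ : Fin (d + 1)) (u : Fin (d + 1) → ℤ) (ρ : Fin (d + 1)) (y : Fin (d + 1) → ℤ) :
    M2Of d Lc (symTablesAn1S2w d Lc cΛ w).mixFF j κ u ρ y = (wM2 d Lc j * w) • symMixFFAt (ctr (d + 1) Lc) Lc κ u ρ y := by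
  rw [symTablesAn1S2w_mixFF]
  show wM2 d Lc j • (w • symMixFFAt (ctr (d + 1) Lc) Lc) κ u ρ y = (wM2 d Lc j * w) • symMixFFAt (ctr (d + 1) Lc) Lc κ u ρ y
  simp only [Pi.smul_apply, smul_smul]

/-- [folklore] **THE d = 3 WEIGHT LOCK AT MIXED WEIGHT `w`** (the `w`-twin of `CombRemainderTadpoleSlot.lock_of_hΛ`; the homogeneous lock of
`CombMixedT2SiteLetterScaled`): for the displayed `γ_j = −(Lc⁸∕2)·wVH_j∕(stepScale_j·Lc⁴)`, `cΛ·Lc⁴ = 2·w ⟹ cΛ·wM1_j·γ_j = −(w·wM2_j)` at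
every level (the weights are `q², q², q, q³`, `q = (Lc^j)^5`).  At `w = 1` this is `lock_of_hΛ`'s statement; at `(cΛ, w) = (Lc⁸∕2, Lc¹²∕4)`
its hypothesis is INTENT-3's `lock_of_borderWeights`. -/
theorem weightLock_of_lock {Lc : ℕ} [NeZero Lc] {cΛ w : ℝ} (hΛ : cΛ * (Lc : ℝ) ^ 4 = 2 * w) (j : ℕ) :
    cΛ * wM1 3 Lc j * (-((Lc : ℝ) ^ 8 / 2) * wVH 3 Lc j / (stepScale 3 Lc j * (Lc : ℝ) ^ 4)) = -(w * wM2 3 Lc j) := by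
  have hL : (Lc : ℝ) ≠ 0 := by exact_mod_cast NeZero.ne Lc
  have hq : ((Lc : ℝ) ^ j) ≠ 0 := pow_ne_zero _ hL
  have hc : cΛ = 2 * w / (Lc : ℝ) ^ 4 := by rw [eq_div_iff (pow_ne_zero _ hL)]; exact hΛ
  simp only [BalabanStepW2.wM1, BalabanStepW2.wM2, BalabanStepJetsSucc.wVH, BorderedHessian.stepScale, hc]
  field_simp
  ring

end Sockets

end

end Summit.QuantumFields.BalabanUV.Beta.SymTablesAn1S2Weighted
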